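import Mathlib.MeasureTheory.Measure.Portmanteau
import Literature.Probability.RandomPlanarGeometry.CurveSpace
import Literature.Probability.RandomPlanarGeometry.SelfAvoidingWalk
import Literature.Probability.RandomPlanarGeometry.SAWRestrictionCovariance
import Summits.CriticalPhenomena.SAWScalingLimit.Theorems.SubseqIdentification.Negative.Necessity

/-!
# `stub_restrictionPassage`: the exact lattice restriction identity passes to subsequential limits

Stub RS3 (portmanteau passage) of the restriction reshape of the line `boundary-area-law` for the
crux `SubseqIdentification` (stmt-CriticalPhenomena-0783, route `SAWRenewalTightness`; primary decl
`SAWParafermion.SubseqIdentification`).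

Setting: two carriers `Ω ⊇ Ω'` (plain sets; in the line `Ω'` is `Ω` with a closed ball about a
boundary point `x₀` removed), common lattice endpoints, meshes `s n`; the critical SAW laws of `Ω`
and `Ω'`, pushed to `CurveClass ℂ` by `γ ↦ γ.curve`, converge weakly to probability measures `μ`,
`μ'`. Eventually in `n`: (a) NESTING — every `Ω'`-walk is (the support of) an `Ω`-walk; (b) every
`Ω`-walk at distance `> r` from `x₀` is an `Ω'`-walk; (c) every `Ω`-walk that is an `Ω'`-walk is at
distance `≥ r` from `x₀`. If `r` is not an atom of `c ↦ dist(x₀, trace c)` under `μ`, then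
`μ'(T) · μ(N) = μ(T ∩ N)` for every Borel `T`, `N = {dist(x₀, trace) ≥ r}`: the limit law of the
small domain is the limit law of the big domain CONDITIONED to avoid the ball (LSW restriction).

Proof.
1. EXACT LATTICE IDENTITY (`SAW.law_confined_inter_preimage_curve_eq`): under nesting, with
   `Conf = {γ is an Ω'-walk}`, `P_Ω(Conf ∩ {curve ∈ E}) = P_Ω(Conf) · P_Ω'({curve ∈ E})` for every
   set `E` of curve classes — the map `γ' ↦ its Ω-copy` is a weight-, length- and
   polyline-preserving bijection onto `Conf` (`Function.Injective.tsum_eq`), and `Z'⁻¹ Z' = 1` for a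
   probability law.
2. PORTMANTEAU, CLOSED SETS (`measure_inter_le_mul_of_tendsto`): for closed `F` and `ε > 0`, with
   `O = {dist > r}` open, `F ⊆ F^ε` (open thickening) `⊆ F̄^ε` (closed thickening),
   `μ(F ∩ N) = μ(F ∩ O) ≤ μ(F^ε ∩ O) ≤ liminf P_n(curve ∈ F^ε ∩ O)`
   `≤ liminf P_n(Conf ∩ {curve ∈ F̄^ε}) = liminf p_n P'_n(curve ∈ F̄^ε)`
   `≤ limsup p_n · limsup P'_n(curve ∈ F̄^ε) ≤ μ(N) · μ'(F̄^ε)`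
   (`p_n = P_n(Conf) ≤ P_n(curve ∈ N)`, portmanteau for the open set `F^ε ∩ O` and the closed sets
   `N`, `F̄^ε`; `ENNReal.limsup_mul_le'`), and `μ'(F̄^ε) → μ'(F)` as `ε → 0⁺`
   (`tendsto_measure_cthickening_of_isClosed`). So `μ(F ∩ N) ≤ μ(N) μ'(F)` for all closed `F`.
3. EQUAL MASS UPGRADE (`ext_of_forall_isClosed_le`): the finite measures `ρ = μ(N) • μ'` and
   `σ = μ|_N` have the same total mass `μ(N)` and `σ(F) ≤ ρ(F)` on closed sets; complementation
   gives `ρ(U) ≤ σ(U)` on open sets, thickening gives `ρ(F) ≤ σ(F)` on closed sets, and closed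
   sets are a π-system generating the Borel σ-algebra (`ext_of_generate_finite`). Hence `ρ = σ`;
   evaluate at `T`.
The laws are probability measures past some index
(`Negative.eventually_isProbabilityMeasure_of_tendsto`, test integral of `f ≡ 1`), where also
(a)–(c) hold; the proof runs along the shifted sequence. The hypothesis `s → 0⁺` is not needed.

References: G. F. Lawler, O. Schramm, W. Werner, *On the scaling limit of planar self-avoiding
walk* (2004), §3 (restriction property of the SAW measures) and §3.4.5; Mathlib's portmanteau.
No named fact is used; axioms `propext`, `Classical.choice`, `Quot.sound`.
-/

noncomputable section

open MeasureTheory Filter Topology Set Metric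
open scoped NNReal ENNReal BoundedContinuousFunction

/-! ### The exact lattice identity, measure form -/

namespace Literature.Probability.RandomPlanarGeometry.SAW

open Literature.Probability.LatticeModels

variable {Ω' Ω : Set ℂ} {δ : ℝ} {u v : Site 2}

/-- **Exact restriction identity, weight form, localised to a set of curves**: under nesting (every
`Ω'_δ`-walk `u → v` is, with the same support, an `Ω_δ`-walk), for every set `E` of curve classes
the weight in `Ω_δ` of "`γ` is an `Ω'_δ`-walk AND its curve lies in `E`" equals the weight in
`Ω'_δ` of "the curve lies in `E`": the map `γ' ↦ its Ω-copy` is an injection onto the confinement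
event preserving length (hence weight) and polyline (hence curve class). Generalises
`weight_setOf_exists_support_eq_eq` (`E = univ`). [folklore] -/
theorem weight_confined_inter_preimage_curve_eq
    (hN : ∀ γ' : DomainSAW Ω' δ u v, ∃ γ : DomainSAW Ω δ u v, γ.walk.support = γ'.walk.support)
    (E : Set (CurveClass ℂ)) :
    weight Ω δ u v ({γ | ∃ γ' : DomainSAW Ω' δ u v, γ'.walk.support = γ.walk.support} ∩
        (fun γ => γ.curve) ⁻¹' E) =
      weight Ω' δ u v ((fun γ' => γ'.curve) ⁻¹' E) := by
  classical
  choose ι hι using hN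
  have hinj : Function.Injective ι := by
    intro γ₁ γ₂ h
    apply DomainSAW.ext_support
    rw [← hι γ₁, ← hι γ₂, h]
  set C : Set (DomainSAW Ω δ u v) :=
    {γ | ∃ γ' : DomainSAW Ω' δ u v, γ'.walk.support = γ.walk.support} ∩ (fun γ => γ.curve) ⁻¹' E
    with hC
  have hcurve : ∀ γ', (ι γ').curve = γ'.curve := fun γ' => by
    simp only [DomainSAW.curve, DomainSAW.toCurve_eq_of_support_eq (hι γ')]
  have hmem : ∀ γ', ι γ' ∈ C ↔ γ'.curve ∈ E := fun γ' => by
    simp only [hC, Set.mem_inter_iff, Set.mem_setOf_eq, Set.mem_preimage, hcurve]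
    exact ⟨fun h => h.2, fun h => ⟨⟨γ', (hι γ').symm⟩, h⟩⟩
  rw [weight_apply_eq_tsum_indicator, weight_apply_eq_tsum_indicator]
  -- the summand of the left side vanishes off the range of `ι`
  have hsupp : Function.support
      (C.indicator fun γ => ENNReal.ofReal (criticalFugacity ^ γ.length)) ⊆ Set.range ι := by
    intro γ hγ
    obtain ⟨γ', hγ'⟩ := (Set.support_indicator_subset hγ).1
    exact ⟨γ', DomainSAW.ext_support ((hι γ').trans hγ')⟩
  rw [← hinj.tsum_eq hsupp]
  refine tsum_congr fun γ' => ?_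
  by_cases h : γ'.curve ∈ E
  · rw [Set.indicator_of_mem ((hmem γ').2 h),
      Set.indicator_of_mem (show γ' ∈ (fun γ' => γ'.curve) ⁻¹' E from h),
      DomainSAW.length_eq_of_support_eq (hι γ')]
  · rw [Set.indicator_of_notMem fun h' => h ((hmem γ').1 h'),
      Set.indicator_of_notMem (show γ' ∉ (fun γ' => γ'.curve) ⁻¹' E from h)]

/-- **Exact restriction identity of the critical SAW law, product form** (Lawler–Schramm–Werner's
restriction property on the lattice): under nesting, and when the law of the small domain is a
genuine probability measure, for every set `E` of curve classes
`P_Ω(γ is an Ω'-walk ∧ curve ∈ E) = P_Ω(γ is an Ω'-walk) · P_Ω'(curve ∈ E)`, i.e. the big-domain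
walk conditioned to be a small-domain walk IS the small-domain walk. With `Z = weight Ω univ`,
`Z' = weight Ω' univ`: `Z⁻¹ W'(E) = (Z⁻¹ Z') (Z'⁻¹ W'(E))` as `Z'⁻¹ Z' = P_Ω'(univ) = 1`.
[folklore] -/
theorem law_confined_inter_preimage_curve_eq
    (hN : ∀ γ' : DomainSAW Ω' δ u v, ∃ γ : DomainSAW Ω δ u v, γ.walk.support = γ'.walk.support)
    [IsProbabilityMeasure (law Ω' δ u v)] (E : Set (CurveClass ℂ)) :
    law Ω δ u v ({γ | ∃ γ' : DomainSAW Ω' δ u v, γ'.walk.support = γ.walk.support} ∩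
        (fun γ => γ.curve) ⁻¹' E) =
      law Ω δ u v {γ | ∃ γ' : DomainSAW Ω' δ u v, γ'.walk.support = γ.walk.support} *
        law Ω' δ u v ((fun γ' => γ'.curve) ⁻¹' E) := by
  have h1 : (weight Ω' δ u v univ)⁻¹ * weight Ω' δ u v univ = 1 := by
    rw [← law_apply_eq_inv_mul_weight]
    exact measure_univ
  rw [law_setOf_exists_support_eq_eq hN, law_apply_eq_inv_mul_weight, law_apply_eq_inv_mul_weight,
    weight_confined_inter_preimage_curve_eq hN E]
  set Z := weight Ω δ u v univ
  set Z' := weight Ω' δ u v univ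
  set W := weight Ω' δ u v ((fun γ' => γ'.curve) ⁻¹' E)
  calc Z⁻¹ * W = Z⁻¹ * (Z'⁻¹ * Z') * W := by rw [h1, mul_one]
    _ = Z⁻¹ * Z' * (Z'⁻¹ * W) := by ring

end Literature.Probability.RandomPlanarGeometry.SAW

namespace Summit.CriticalPhenomena.SAWScalingLimit.Theorems.SubseqIdentification.BoundaryAreaLaw

open Literature.Probability.RandomPlanarGeometry Literature.Probability.LatticeModels

/-! ### Two abstract measure-theoretic lemmas on a metric space -/

section Limit

variable {X : Type*} [PseudoMetricSpace X] [MeasurableSpace X] [OpensMeasurableSpace X]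

/-- **Portmanteau transfer of a product identity to closed sets.** Probability measures `ν n → μ`,
`ν' n → μ'` weakly; `O` open, `N` closed with `N ⊆ O ∪ Z`, `μ Z = 0`; numbers `p n ≤ ν n N`; and the
lattice-side inequality `ν n (B ∩ O) ≤ p n · ν' n B` for Borel `B`. Then
`μ (F ∩ N) ≤ μ N · μ' F` for every closed `F`: through the open/closed `ε`-thickenings of `F`,
`μ(F ∩ N) = μ(F ∩ O) ≤ liminf ν n (F^ε ∩ O) ≤ limsup (p n · ν' n F̄^ε) ≤ μ N · μ' F̄^ε`
`→ μ N · μ' F` as `ε → 0⁺`. [folklore] -/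
theorem measure_inter_le_mul_of_tendsto {μ μ' : Measure X} [hμ : IsProbabilityMeasure μ]
    [hμ' : IsProbabilityMeasure μ'] {ν ν' : ℕ → Measure X}
    {hνp : ∀ n, IsProbabilityMeasure (ν n)} {hν'p : ∀ n, IsProbabilityMeasure (ν' n)}
    (hν : Tendsto (β := ProbabilityMeasure X) (fun n => ⟨ν n, hνp n⟩) atTop (𝓝 ⟨μ, hμ⟩))
    (hν' : Tendsto (β := ProbabilityMeasure X) (fun n => ⟨ν' n, hν'p n⟩) atTop (𝓝 ⟨μ', hμ'⟩))
    {p : ℕ → ℝ≥0∞} {O N Z : Set X} (hO : IsOpen O) (hN : IsClosed N) (hNO : N ⊆ O ∪ Z)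
    (hZ : μ Z = 0) (h1 : ∀ (n) (B : Set X), MeasurableSet B → ν n (B ∩ O) ≤ p n * ν' n B)
    (h2 : ∀ n, p n ≤ ν n N) {F : Set X} (hF : IsClosed F) :
    μ (F ∩ N) ≤ μ N * μ' F := by
  -- bound through the closed `ε`-thickenings of `F`
  have key : ∀ ε : ℝ, 0 < ε → μ (F ∩ N) ≤ μ N * μ' (cthickening ε F) := by
    intro ε hε
    have hp : limsup p atTop ≤ μ N :=
      (limsup_le_limsup (Eventually.of_forall h2)).trans
        (ProbabilityMeasure.limsup_measure_closed_le_of_tendsto hν hN)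
    have hC : limsup (fun n => ν' n (cthickening ε F)) atTop ≤ μ' (cthickening ε F) :=
      ProbabilityMeasure.limsup_measure_closed_le_of_tendsto hν' isClosed_cthickening
    calc μ (F ∩ N)
        ≤ μ (F ∩ O ∪ Z) := by
          refine measure_mono ?_
          rintro x ⟨hxF, hxN⟩
          exact (hNO hxN).elim (fun h => Or.inl ⟨hxF, h⟩) Or.inr
      _ ≤ μ (F ∩ O) + μ Z := measure_union_le _ _
      _ = μ (F ∩ O) := by rw [hZ, add_zero]
      _ ≤ μ (thickening ε F ∩ O) :=
          measure_mono (inter_subset_inter_left _ (self_subset_thickening hε F))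
      _ ≤ liminf (fun n => ν n (thickening ε F ∩ O)) atTop :=
          ProbabilityMeasure.le_liminf_measure_open_of_tendsto hν (isOpen_thickening.inter hO)
      _ ≤ liminf (fun n => p n * ν' n (cthickening ε F)) atTop :=
          liminf_le_liminf (Eventually.of_forall fun n =>
            (measure_mono (inter_subset_inter_left _ (thickening_subset_cthickening ε F))).trans
              (h1 n _ isClosed_cthickening.measurableSet))
      _ ≤ limsup (fun n => p n * ν' n (cthickening ε F)) atTop := liminf_le_limsup
      _ ≤ limsup p atTop * limsup (fun n => ν' n (cthickening ε F)) atTop :=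
          ENNReal.limsup_mul_le' (u := p) (v := fun n => ν' n (cthickening ε F))
            (Or.inr (hC.trans_lt (measure_lt_top _ _)).ne)
            (Or.inl (hp.trans_lt (measure_lt_top _ _)).ne)
      _ ≤ μ N * μ' (cthickening ε F) := mul_le_mul' hp hC
  -- let `ε → 0⁺`
  have hlim : Tendsto (fun ε : ℝ => μ N * μ' (cthickening ε F)) (𝓝[>] 0) (𝓝 (μ N * μ' F)) :=
    (ENNReal.Tendsto.const_mul (tendsto_measure_cthickening_of_isClosed
      ⟨1, one_pos, measure_ne_top _ _⟩ hF) (Or.inr (measure_ne_top _ _))).mono_left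
      nhdsWithin_le_nhds
  exact ge_of_tendsto hlim (eventually_nhdsWithin_of_forall fun ε hε => key ε hε)

end Limit

section Ext

variable {X : Type*} [PseudoMetricSpace X] [MeasurableSpace X] [BorelSpace X]

/-- **One-sided comparison on closed sets + equal mass ⇒ equality.** Two finite Borel measures on
a (pseudo)metric space with the same total mass and `σ F ≤ ρ F` for all closed `F` are equal:
complementation gives `ρ U ≤ σ U` for open `U`, so `ρ F ≤ ρ F^ε ≤ σ F^ε ≤ σ F̄^ε → σ F`
(`ε → 0⁺`), whence equality on the π-system of closed sets, which generates the Borel σ-algebra.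
[folklore] -/
theorem ext_of_forall_isClosed_le {ρ σ : Measure X} [IsFiniteMeasure ρ] [IsFiniteMeasure σ]
    (huniv : ρ univ = σ univ) (hle : ∀ F : Set X, IsClosed F → σ F ≤ ρ F) : ρ = σ := by
  have key : ∀ F : Set X, IsClosed F → ρ F = σ F := by
    intro F hF
    refine le_antisymm ?_ (hle F hF)
    have hlim : Tendsto (fun ε : ℝ => σ (cthickening ε F)) (𝓝[>] 0) (𝓝 (σ F)) :=
      (tendsto_measure_cthickening_of_isClosed ⟨1, one_pos, measure_ne_top _ _⟩ hF).mono_left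
        nhdsWithin_le_nhds
    refine ge_of_tendsto hlim (eventually_nhdsWithin_of_forall fun ε (hε : 0 < ε) => ?_)
    have hU : IsOpen (thickening ε F) := isOpen_thickening
    have hadd : ρ (thickening ε F) + ρ (thickening ε F)ᶜ ≤
        σ (thickening ε F) + ρ (thickening ε F)ᶜ :=
      calc ρ (thickening ε F) + ρ (thickening ε F)ᶜ = ρ univ :=
            measure_add_measure_compl hU.measurableSet
        _ = σ (thickening ε F) + σ (thickening ε F)ᶜ := by
            rw [huniv, measure_add_measure_compl hU.measurableSet]
        _ ≤ σ (thickening ε F) + ρ (thickening ε F)ᶜ :=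
            add_le_add le_rfl (hle _ hU.isClosed_compl)
    calc ρ F ≤ ρ (thickening ε F) := measure_mono (self_subset_thickening hε F)
      _ ≤ σ (thickening ε F) := (ENNReal.add_le_add_iff_right (measure_ne_top ρ _)).1 hadd
      _ ≤ σ (cthickening ε F) := measure_mono (thickening_subset_cthickening ε F)
  refine ext_of_generate_finite _ ?_ isPiSystem_isClosed (fun F hF => key F hF) huniv
  rw [BorelSpace.measurable_eq (α := X), borel_eq_generateFrom_isClosed]

end Ext

/-! ### The SAW side -/

/-- `c ↦ dist(x₀, trace c)` is `1`-Lipschitz for the reparametrisation distance on curve classes: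
every point of one trace is within `dist c₁ c₂` of the other trace (`Curve.infDist_range_le`).
[folklore] -/
private theorem lipschitzWith_infDist_range_rp (z : ℂ) :
    LipschitzWith 1 fun c : CurveClass ℂ => Metric.infDist z c.range := by
  -- adapted from `Literature/Barriers/CriticalPhenomena/SupercriticalSAWSpaceFillingProofs.lean`,
  -- `SupercriticalSAW.lipschitzWith_infDist_range`
  refine LipschitzWith.of_le_add fun c₁ c₂ => ?_
  obtain ⟨γ₁, rfl⟩ := CurveClass.surjective_mk c₁
  obtain ⟨γ₂, rfl⟩ := CurveClass.surjective_mk c₂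
  simp only [CurveClass.range_mk, CurveClass.dist_mk_mk]
  have key : ∀ ⦃y⦄, y ∈ γ₂.range → Metric.infDist z γ₁.range - dist γ₁ γ₂ ≤ dist z y := by
    rintro y ⟨t, rfl⟩
    have h₁ := Curve.infDist_range_le γ₂ γ₁ t
    have h₂ := Metric.infDist_le_infDist_add_dist (s := γ₁.range) (x := z) (y := γ₂ t)
    rw [dist_comm γ₂ γ₁] at h₁
    linarith
  have h := (Metric.le_infDist γ₂.range_nonempty).2 key
  linarith

/-- The image of a probability SAW law under `γ ↦ γ.curve`, as a `ProbabilityMeasure`, converges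
to `μ` when the test integrals `∫ f(γ.curve) dP_n → ∫ f dμ` converge (`integral_map`). [folklore] -/
theorem tendsto_map_curve_of_forall_integral_tendsto {Ω : Set ℂ} {a b : ℝ → Site 2} {t : ℕ → ℝ}
    {μ : Measure (CurveClass ℂ)} [hμ : IsProbabilityMeasure μ]
    (hP : ∀ n, IsProbabilityMeasure (SAW.law Ω (t n) (a (t n)) (b (t n))))
    (hlim : ∀ f : CurveClass ℂ →ᵇ ℝ,
      Tendsto (fun n => ∫ γ, f γ.curve ∂(SAW.law Ω (t n) (a (t n)) (b (t n)))) atTop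
        (𝓝 (∫ x, f x ∂μ))) :
    Tendsto (β := ProbabilityMeasure (CurveClass ℂ))
      (fun n => ⟨(SAW.law Ω (t n) (a (t n)) (b (t n))).map (fun γ => γ.curve),
        Measure.isProbabilityMeasure_map (SAW.DomainSAW.measurable_of_top _).aemeasurable⟩)
      atTop (𝓝 ⟨μ, hμ⟩) := by
  refine ProbabilityMeasure.tendsto_iff_forall_integral_tendsto.2 fun f => ?_
  refine (hlim f).congr fun n => ?_
  change ∫ γ, f γ.curve ∂(SAW.law Ω (t n) (a (t n)) (b (t n))) =
    ∫ x, f x ∂((SAW.law Ω (t n) (a (t n)) (b (t n))).map (fun γ => γ.curve))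
  exact (integral_map (SAW.DomainSAW.measurable_of_top _).aemeasurable
    f.continuous.aestronglyMeasurable).symm

/-- **The closed-set inequality along a good sequence.** If ALL the laws along `t` are probability
measures, converge weakly (pushed by `γ ↦ γ.curve`) to `μ`, `μ'`, and satisfy (a) nesting, (b)
`{dist > r} ⊆ Conf`, (c) `Conf ⊆ {dist ≥ r}` at every index, and `μ {dist = r} = 0`, then
`μ (F ∩ {dist ≥ r}) ≤ μ {dist ≥ r} · μ' F` for every closed `F` (lattice identity + portmanteau).
[folklore] -/
theorem measure_inter_le_mul_of_saw (Ω Ω' : Set ℂ) (a b : ℝ → Site 2) (t : ℕ → ℝ)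
    (μ μ' : Measure (CurveClass ℂ)) (x₀ : ℂ) (r : ℝ) [hμ : IsProbabilityMeasure μ]
    [hμ' : IsProbabilityMeasure μ']
    (hP : ∀ n, IsProbabilityMeasure (SAW.law Ω (t n) (a (t n)) (b (t n))))
    (hP' : ∀ n, IsProbabilityMeasure (SAW.law Ω' (t n) (a (t n)) (b (t n))))
    (hlim : ∀ f : CurveClass ℂ →ᵇ ℝ,
      Tendsto (fun n => ∫ γ, f γ.curve ∂(SAW.law Ω (t n) (a (t n)) (b (t n)))) atTop
        (𝓝 (∫ x, f x ∂μ)))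
    (hlim' : ∀ f : CurveClass ℂ →ᵇ ℝ,
      Tendsto (fun n => ∫ γ, f γ.curve ∂(SAW.law Ω' (t n) (a (t n)) (b (t n)))) atTop
        (𝓝 (∫ x, f x ∂μ')))
    (hn : ∀ n,
      (∀ γ' : SAW.DomainSAW Ω' (t n) (a (t n)) (b (t n)),
          ∃ γ : SAW.DomainSAW Ω (t n) (a (t n)) (b (t n)), γ.walk.support = γ'.walk.support) ∧
      (∀ γ : SAW.DomainSAW Ω (t n) (a (t n)) (b (t n)), r < Metric.infDist x₀ γ.curve.range →
          ∃ γ' : SAW.DomainSAW Ω' (t n) (a (t n)) (b (t n)), γ'.walk.support = γ.walk.support) ∧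
      (∀ γ : SAW.DomainSAW Ω (t n) (a (t n)) (b (t n)),
          (∃ γ' : SAW.DomainSAW Ω' (t n) (a (t n)) (b (t n)), γ'.walk.support = γ.walk.support) →
          r ≤ Metric.infDist x₀ γ.curve.range))
    (hnull : μ {c | Metric.infDist x₀ c.range = r} = 0) {F : Set (CurveClass ℂ)}
    (hF : IsClosed F) :
    μ (F ∩ {c | r ≤ Metric.infDist x₀ c.range}) ≤ μ {c | r ≤ Metric.infDist x₀ c.range} * μ' F := by
  have hcont : Continuous fun c : CurveClass ℂ => Metric.infDist x₀ c.range :=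
    (lipschitzWith_infDist_range_rp x₀).continuous
  have hO : IsOpen {c : CurveClass ℂ | r < Metric.infDist x₀ c.range} :=
    isOpen_lt continuous_const hcont
  have hN : IsClosed {c : CurveClass ℂ | r ≤ Metric.infDist x₀ c.range} :=
    isClosed_le continuous_const hcont
  have hmeas : ∀ n, Measurable fun γ : SAW.DomainSAW Ω (t n) (a (t n)) (b (t n)) => γ.curve :=
    fun n => SAW.DomainSAW.measurable_of_top _
  have hmeas' : ∀ n, Measurable fun γ : SAW.DomainSAW Ω' (t n) (a (t n)) (b (t n)) => γ.curve :=
    fun n => SAW.DomainSAW.measurable_of_top _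
  refine measure_inter_le_mul_of_tendsto (tendsto_map_curve_of_forall_integral_tendsto hP hlim)
    (tendsto_map_curve_of_forall_integral_tendsto hP' hlim')
    (p := fun n => SAW.law Ω (t n) (a (t n)) (b (t n))
      {γ | ∃ γ' : SAW.DomainSAW Ω' (t n) (a (t n)) (b (t n)), γ'.walk.support = γ.walk.support})
    (Z := {c | Metric.infDist x₀ c.range = r}) hO hN ?_ hnull ?_ ?_ hF
  · -- `N ⊆ O ∪ Z`
    intro c hc
    rcases (show r ≤ Metric.infDist x₀ c.range from hc).lt_or_eq with h | h
    · exact Or.inl h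
    · exact Or.inr h.symm
  · -- the lattice identity and (b): `P_n(curve ∈ B ∩ O) ≤ P_n(Conf ∩ curve ∈ B) = p_n P'_n(B)`
    intro n B hB
    obtain ⟨ha, hb, -⟩ := hn n
    rw [Measure.map_apply (hmeas n) (hB.inter hO.measurableSet), Measure.map_apply (hmeas' n) hB,
      ← SAW.law_confined_inter_preimage_curve_eq ha B]
    refine measure_mono ?_
    rintro γ ⟨hγB, hγO⟩
    exact ⟨hb γ hγO, hγB⟩
  · -- (c): `p_n ≤ P_n(curve ∈ N)`
    intro n
    obtain ⟨-, -, hc⟩ := hn n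
    rw [Measure.map_apply (hmeas n) hN.measurableSet]
    exact measure_mono fun γ hγ => hc γ hγ

/-- **RS3 — PASSAGE OF THE EXACT LATTICE RESTRICTION IDENTITY TO SUBSEQUENTIAL LIMITS
(portmanteau; NO SLE input).** Two carriers `Ω ⊇ Ω'`, common endpoints, meshes `s n → 0⁺`; the
pushed critical SAW laws converge weakly to probability measures `μ` (for `Ω`) and `μ'` (for
`Ω'`); eventually (a) every `Ω'`-walk is an `Ω`-walk with the same support, (b) every `Ω`-walk at
distance `> r` from `x₀` is an `Ω'`-walk, (c) every `Ω`-walk that is an `Ω'`-walk is at distance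
`≥ r`; and `r` is not an atom of `dist(x₀, trace)` under `μ`. Then
`μ'(T) · μ(N_r) = μ(T ∩ N_r)` for every Borel `T`, `N_r = {dist(x₀, trace) ≥ r}`.
Proof: the exact identity `P_Ω(Conf ∩ {curve ∈ E}) = P_Ω(Conf) P_Ω'(curve ∈ E)`
(`SAW.law_confined_inter_preimage_curve_eq`) is sandwiched by (b)/(c) between `μ`-continuity
events and passed to the limit on closed sets by portmanteau (`measure_inter_le_mul_of_saw`);
equal total mass `μ(N_r)` of `μ(N_r) • μ'` and `μ|_{N_r}` upgrades the one-sided closed-set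
inequality to equality of measures (`ext_of_forall_isClosed_le`). [folklore] -/
theorem stub_restrictionPassage :
    ∀ (Ω Ω' : Set ℂ) (a b : ℝ → Site 2) (s : ℕ → ℝ) (μ μ' : Measure (CurveClass ℂ)) (x₀ : ℂ) (r : ℝ),
      Tendsto s atTop (𝓝[>] (0 : ℝ)) → IsProbabilityMeasure μ → IsProbabilityMeasure μ' →
      (∀ f : CurveClass ℂ →ᵇ ℝ,
        Tendsto (fun n => ∫ γ, f γ.curve ∂(SAW.law Ω (s n) (a (s n)) (b (s n))))
          atTop (𝓝 (∫ x, f x ∂μ))) →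
      (∀ f : CurveClass ℂ →ᵇ ℝ,
        Tendsto (fun n => ∫ γ, f γ.curve ∂(SAW.law Ω' (s n) (a (s n)) (b (s n))))
          atTop (𝓝 (∫ x, f x ∂μ'))) →
      (∀ᶠ n in atTop,
          (∀ γ' : SAW.DomainSAW Ω' (s n) (a (s n)) (b (s n)),
              ∃ γ : SAW.DomainSAW Ω (s n) (a (s n)) (b (s n)), γ.walk.support = γ'.walk.support) ∧
          (∀ γ : SAW.DomainSAW Ω (s n) (a (s n)) (b (s n)), r < Metric.infDist x₀ γ.curve.range →
              ∃ γ' : SAW.DomainSAW Ω' (s n) (a (s n)) (b (s n)), γ'.walk.support = γ.walk.support) ∧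
          (∀ γ : SAW.DomainSAW Ω (s n) (a (s n)) (b (s n)),
              (∃ γ' : SAW.DomainSAW Ω' (s n) (a (s n)) (b (s n)), γ'.walk.support = γ.walk.support) →
              r ≤ Metric.infDist x₀ γ.curve.range)) →
      μ {c | Metric.infDist x₀ c.range = r} = 0 →
      ∀ T : Set (CurveClass ℂ), MeasurableSet T →
        μ' T * μ {c | r ≤ Metric.infDist x₀ c.range} = μ (T ∩ {c | r ≤ Metric.infDist x₀ c.range}) := by
  intro Ω Ω' a b s μ μ' x₀ r _ hμ hμ' hlim hlim' hev hnull
  haveI := hμ; haveI := hμ'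
  -- one index past which both laws are probability measures and (a), (b), (c) hold
  obtain ⟨N₀, hN₀⟩ := eventually_atTop.1
    ((Negative.eventually_isProbabilityMeasure_of_tendsto (hlim 1)).and
      ((Negative.eventually_isProbabilityMeasure_of_tendsto (hlim' 1)).and hev))
  -- the closed-set inequality along the shifted sequence `k ↦ s (k + N₀)`
  have hclosed : ∀ F : Set (CurveClass ℂ), IsClosed F →
      μ (F ∩ {c | r ≤ Metric.infDist x₀ c.range}) ≤
        μ {c | r ≤ Metric.infDist x₀ c.range} * μ' F :=
    fun F hF => measure_inter_le_mul_of_saw Ω Ω' a b (fun k => s (k + N₀)) μ μ' x₀ r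
      (fun k => (hN₀ _ (N₀.le_add_left k)).1) (fun k => (hN₀ _ (N₀.le_add_left k)).2.1)
      (fun f => (hlim f).comp (tendsto_add_atTop_nat N₀))
      (fun f => (hlim' f).comp (tendsto_add_atTop_nat N₀))
      (fun k => (hN₀ _ (N₀.le_add_left k)).2.2) hnull hF
  -- equal mass: `μ N • μ' = μ|_N`
  have hfin : IsFiniteMeasure (μ {c | r ≤ Metric.infDist x₀ c.range} • μ') :=
    Measure.smul_finite μ' (measure_ne_top _ _)
  have heq : μ {c | r ≤ Metric.infDist x₀ c.range} • μ' =
      μ.restrict {c | r ≤ Metric.infDist x₀ c.range} := by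
    refine ext_of_forall_isClosed_le ?_ fun F hF => ?_
    · rw [Measure.smul_apply, smul_eq_mul, measure_univ, mul_one, Measure.restrict_apply_univ]
    · rw [Measure.restrict_apply hF.measurableSet, Measure.smul_apply, smul_eq_mul]
      exact hclosed F hF
  intro T hT
  have h := congrArg (fun m : Measure (CurveClass ℂ) => m T) heq
  simp only [Measure.smul_apply, smul_eq_mul, Measure.restrict_apply hT] at h
  rw [mul_comm, h]

end Summit.CriticalPhenomena.SAWScalingLimit.Theorems.SubseqIdentification.BoundaryAreaLaw

end
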